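import Summits.ValiantsHypothesis.ValiantsHypothesis.Theorems.NewtonUnitEquationsTwoProductsTowerRecordCramer

/-!
# R13∞-coeff — GRASSMANN–PLÜCKER EXCHANGE and the RANK POTENTIAL (val-idea-37 g4 rev 5 §12, part 1/3)

(8a) `rowM`/`gp_rows`/`gp_minor` (in-place Grassmann–Plücker over `ℂ[X]`: Cramer `Matrix.mulVec_cramer` + row-linearity of `det`), `score`/`IsOpt`
(ξ-optimal column selections with a marked exponent), `topExp`, ★ `opt_exchange` (symmetric exchange inside `Opt(ξ)` read off the `z^{ŝ₁+ŝ₂}` coefficient of GP),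
`injective_of_isOpt`, the rank potential `phiN`/`Psi` and ★ `psi_chain` (inside `Opt(ξ)`, `Ψ` rises towards the `ζ`-maximal selection, strictly across a
strict `ζ`-gap).
Transplant (val-lit-p3 g18) of val-idea-37 g4's kernel-checked scratch `Cruxes/TwoProducts/TowerRecords_val_idea_37_g4.lean` (rev 5 §12,
sha16 bf5159e121ff5e9d (§1–§11 = rev 4 2a92eb1f7d59f466); val-idea-crit-8 g2 VERDICT #20 by-name check, ns `ValIdea37g4T`; val-idea-crit-8 g2 VERDICT #19 + addendum: KEEP «R13-coeff», by-name GO for a verbatim transplant);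
proofs verbatim by name, docstrings added, namespace = the tree's.  Helper on crux `stmt-ValiantsHypothesis-5906` (`TwoProducts`, line
`relation_ladder`); `--supports`, closes nothing by itself.  HONEST LABEL (crit-8 #19): COEFFICIENT-SIDE; the class rung it feeds (R13, dense
parallel towers on dissociated carriers) is a wider CLASS rung, inert as a hatch; F10's collinear digit towers NOT covered; `ResidualLawV24` ⟺
`PlanarCellBound`, the crux (stmt-5906), every `closes` binder and every summit statement UNMOVED; VP ≠ VNP is NOT proved.
Credit: mathematics and kernel proofs val-idea-37 g4; critic of record val-idea-crit-8 g2.  No instances, no notation, no named facts. [folklore]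
-/

set_option linter.dupNamespace false

noncomputable section

open Classical

namespace Summit.ValiantsHypothesis.ValiantsHypothesis.Theorems.NewtonUnitEquations.TwoProducts.TowerRecord

open scoped BigOperators
open Module Polynomial
open Summit.ValiantsHypothesis.ValiantsHypothesis.Theorems.NewtonUnitEquations.TwoProducts.FormalLogLinearisation
open Summit.ValiantsHypothesis.ValiantsHypothesis.Theorems.NewtonUnitEquations.TwoProducts.MomentRecord
open Summit.ValiantsHypothesis.ValiantsHypothesis.Theorems.NewtonUnitEquations.TwoProducts.PlanarCell

variable {m n : ℕ}

/-! ## 12. `VertexWalkBound` and `LevelFreeRecordLaw` in the kernel (rev 5): Grassmann–Plücker exchange, rank potential, envelope walk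

(i) `gp_rows`/`gp_minor`: in-place Grassmann–Plücker over `ℂ[X]` (Cramer's rule `Matrix.mulVec_cramer` + row-linearity of `det`).
(ii) `opt_exchange`: for `ξ`-optimal `(β₁,s₁)`, `(β₂,s₂)` (rows `ρ` fixed) and `u₁` there is `u₂` with BOTH exchanged selections optimal —
read off the `z^{ŝ₁+ŝ₂}` coefficient of GP, `ŝ = natDegree` if `ξ·d ≥ 0`, `natTrailingDegree` if `< 0` (`topExp`).
(iii) `psi_chain`: `Ψ(β) = Σ_u #{b'' : ζ·x_{b''} < ζ·x_{β u}}`; inside `Opt(ξ)`, if `β⁺` is `ζ`-maximal then `Ψ β ≤ Ψ β⁺`, strictly if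
`ζ·x(β) < ζ·x(β⁺)` (induction on `#{u : β u ∉ range β⁺}` using (ii) and injectivity of optimal selections).
(iv) `envelope`/`exists_lineFamily` (abstract, any finite `T`, scores `α + θσ`): if (F3) `Ψ` rises strictly towards the right vertex inside
every optimal set, then between right vertices at `θ₁ < θ₂` that differ as points `Ψ` rises strictly (strong induction on the crossing set
`{o : σ p < σ o}` through the next breakpoint `μ = min (α p − α o)/(σ o − σ p)`), so the right vertex FACTORS THROUGH `Φ = max Ψ ∈ [0, B]`:
`≤ B+1` right vertices per line.  Assembly (`vertexWalkBound_holds`): frame `ν = d`, `ζ = d^⊥` (`d = 0`: `e₀, e₁`), every `ξ = aν + bζ`;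
`a > 0`: `Opt(ξ) = Opt(ν + (b/a)ζ)` (positive scaling), `a < 0`: the line `−ν + θζ`, `a = 0`: `Opt(±ζ)`, `Opt(0)`; the letter set
`N = ⋂_{p ∈ RV} range p` has `≤ r ≤ 2m` elements and contains the record letters (Cramer cover `letters_subset_of_isOpt`); in all
`≤ 2(r(n−1)+1) + 3 ≤ 4mn + 4` sets (`m, n ≥ 1`; else `{∅}`).  Hence `levelFreeRecordLaw_holds`. -/

section Walk

/-- Row form of the pencil minor matrix (rows = selected carriers, columns = selected factor rows). -/
def rowM (γ γ' : Fin m → Fin n → ℂ[X]) {r : ℕ} (ρ : Fin r → Fin m ⊕ Fin m) (β : Fin r → Fin n) :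
    Matrix (Fin r) (Fin r) ℂ[X] :=
  Matrix.of fun u p => tvec γ γ' (β u) (ρ p)

/-- The pencil minor is the determinant of its row form. [folklore] -/
theorem minorT_eq_rowM (γ γ' : Fin m → Fin n → ℂ[X]) {r : ℕ} (ρ : Fin r → Fin m ⊕ Fin m) (β : Fin r → Fin n) :
    minorT γ γ' ρ β = (rowM γ γ' ρ β).det := by
  unfold minorT rowM
  rw [← Matrix.det_transpose]
  rfl

/-- Updating one selected carrier updates one row of the row form. [folklore] -/
theorem rowM_updateRow (γ γ' : Fin m → Fin n → ℂ[X]) {r : ℕ} (ρ : Fin r → Fin m ⊕ Fin m) (β : Fin r → Fin n)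
    (u₁ : Fin r) (b : Fin n) :
    (rowM γ γ' ρ β).updateRow u₁ (fun p => tvec γ γ' b (ρ p)) = rowM γ γ' ρ (Function.update β u₁ b) := by
  ext u p
  simp only [Matrix.updateRow_apply, rowM, Matrix.of_apply, Function.update_apply]
  split_ifs <;> rfl

/-- Determinant as a linear function of one row. -/
def rowDetLin {r : ℕ} (M : Matrix (Fin r) (Fin r) ℂ[X]) (j : Fin r) : (Fin r → ℂ[X]) →ₗ[ℂ[X]] ℂ[X] where
  toFun w := (M.updateRow j w).det
  map_add' u v := Matrix.det_updateRow_add M j u v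
  map_smul' c u := by simp only [Matrix.det_updateRow_smul, smul_eq_mul, RingHom.id_apply]

/-- GRASSMANN–PLÜCKER, in-place row form: Cramer's rule + linearity of `det` in one row. -/
theorem gp_rows {r : ℕ} (R₁ R₂ : Matrix (Fin r) (Fin r) ℂ[X]) (u₁ : Fin r) :
    R₂.det * R₁.det = ∑ u, (R₂.updateRow u (R₁ u₁)).det * (R₁.updateRow u₁ (R₂ u)).det := by
  have hc := Matrix.mulVec_cramer (Matrix.transpose R₂) (R₁ u₁)
  rw [Matrix.det_transpose] at hc
  have hfun : R₂.det • R₁ u₁ = ∑ u, (Matrix.cramer (Matrix.transpose R₂) (R₁ u₁) u) • R₂ u := by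
    rw [← hc]
    funext p
    simp only [Matrix.mulVec, dotProduct, Matrix.transpose_apply, Finset.sum_apply, Pi.smul_apply, smul_eq_mul]
    exact Finset.sum_congr rfl fun u _ => mul_comm _ _
  have key : ∀ w, (R₁.updateRow u₁ w).det = rowDetLin R₁ u₁ w := fun w => rfl
  calc R₂.det * R₁.det = rowDetLin R₁ u₁ (R₂.det • R₁ u₁) := by
        rw [map_smul, smul_eq_mul, ← key, Matrix.updateRow_eq_self]
    _ = rowDetLin R₁ u₁ (∑ u, (Matrix.cramer (Matrix.transpose R₂) (R₁ u₁) u) • R₂ u) := by rw [hfun]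
    _ = ∑ u, Matrix.cramer (Matrix.transpose R₂) (R₁ u₁) u * rowDetLin R₁ u₁ (R₂ u) := by
        rw [map_sum]
        simp only [map_smul, smul_eq_mul]
    _ = ∑ u, (R₂.updateRow u (R₁ u₁)).det * (R₁.updateRow u₁ (R₂ u)).det := by
        refine Finset.sum_congr rfl fun u _ => ?_
        rw [Matrix.cramer_apply, Matrix.updateCol_transpose, Matrix.det_transpose, ← key]

/-- GP for pencil minors. -/
theorem gp_minor (γ γ' : Fin m → Fin n → ℂ[X]) {r : ℕ} (ρ : Fin r → Fin m ⊕ Fin m) (β₁ β₂ : Fin r → Fin n)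
    (u₁ : Fin r) :
    minorT γ γ' ρ β₂ * minorT γ γ' ρ β₁
      = ∑ u, minorT γ γ' ρ (Function.update β₂ u (β₁ u₁)) * minorT γ γ' ρ (Function.update β₁ u₁ (β₂ u)) := by
  simp only [minorT_eq_rowM]
  rw [gp_rows (rowM γ γ' ρ β₁) (rowM γ γ' ρ β₂) u₁]
  refine Finset.sum_congr rfl fun u _ => ?_
  rw [← rowM_updateRow γ γ' ρ β₂ u (β₁ u₁), ← rowM_updateRow γ γ' ρ β₁ u₁ (β₂ u)]
  rfl

/-- Score of a (column selection, exponent) pair at weight `ξ`. -/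
def score (ξ : Fin 2 → ℝ) (x : Fin n → Expo) (d : Fin 2 → ℤ) {r : ℕ} (β : Fin r → Fin n) (s : ℕ) : ℝ :=
  wsum ξ x β + (s : ℝ) * wtZ ξ d

/-- `ξ`-optimality of `(β, s)` among pairs with `coeff s (minor β) ≠ 0` (rows `ρ` fixed). -/
def IsOpt (γ γ' : Fin m → Fin n → ℂ[X]) (x : Fin n → Expo) (d : Fin 2 → ℤ) (ξ : Fin 2 → ℝ) {r : ℕ}
    (ρ : Fin r → Fin m ⊕ Fin m) (β : Fin r → Fin n) (s : ℕ) : Prop :=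
  (minorT γ γ' ρ β).coeff s ≠ 0 ∧
    ∀ (β' : Fin r → Fin n) (s' : ℕ), (minorT γ γ' ρ β').coeff s' ≠ 0 → score ξ x d β' s' ≤ score ξ x d β s

/-- Weight of a selection with one column replaced. [folklore] -/
theorem wsum_update (ξ : Fin 2 → ℝ) (x : Fin n → Expo) {r : ℕ} (β : Fin r → Fin n) (u₁ : Fin r) (b : Fin n) :
    wsum ξ x (Function.update β u₁ b) = wsum ξ x β - wt ξ (x (β u₁)) + wt ξ (x b) := by
  simp only [wsum]
  have h : ∀ u, wt ξ (x (Function.update β u₁ b u))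
      = wt ξ (x (β u)) + (if u = u₁ then wt ξ (x b) - wt ξ (x (β u₁)) else 0) := by
    intro u
    by_cases hu : u = u₁
    · subst hu
      simp
    · simp [hu]
  rw [Finset.sum_congr rfl fun u _ => h u, Finset.sum_add_distrib, Finset.sum_ite_eq' Finset.univ u₁]
  simp only [Finset.mem_univ, if_true]
  ring

/-- The `ξ`-extreme exponent of a polynomial: top degree if `ξ·d ≥ 0`, bottom degree otherwise. -/
def topExp (c : ℝ) (P : ℂ[X]) : ℕ := if 0 ≤ c then P.natDegree else P.natTrailingDegree

/-- The top exponent carries a nonzero coefficient. [folklore] -/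
theorem coeff_topExp_ne (c : ℝ) {P : ℂ[X]} (hP : P ≠ 0) : P.coeff (topExp c P) ≠ 0 := by
  unfold topExp
  split_ifs
  · exact Polynomial.leadingCoeff_ne_zero.mpr hP
  · exact mt Polynomial.trailingCoeff_eq_zero.mp hP

/-- Every exponent of the support scores at most the top exponent (`c = ξ·d`). [folklore] -/
theorem topExp_score_le (c : ℝ) {P : ℂ[X]} {s : ℕ} (hs : P.coeff s ≠ 0) : (s : ℝ) * c ≤ (topExp c P : ℝ) * c := by
  unfold topExp
  split_ifs with hc
  · exact mul_le_mul_of_nonneg_right (by exact_mod_cast Polynomial.le_natDegree_of_ne_zero hs) hc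
  · exact mul_le_mul_of_nonpos_right (by exact_mod_cast Polynomial.natTrailingDegree_le_of_ne_zero hs) (le_of_lt (not_le.mp hc))

/-- The product's coefficient at the sum of the top exponents is nonzero. [folklore] -/
theorem coeff_mul_topExp_ne (c : ℝ) {P Q : ℂ[X]} (hP : P ≠ 0) (hQ : Q ≠ 0) :
    (P * Q).coeff (topExp c P + topExp c Q) ≠ 0 := by
  unfold topExp
  split_ifs
  · rw [Polynomial.coeff_mul_degree_add_degree]
    exact mul_ne_zero (Polynomial.leadingCoeff_ne_zero.mpr hP) (Polynomial.leadingCoeff_ne_zero.mpr hQ)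
  · rw [Polynomial.coeff_mul_natTrailingDegree_add_natTrailingDegree]
    exact mul_ne_zero (mt Polynomial.trailingCoeff_eq_zero.mp hP) (mt Polynomial.trailingCoeff_eq_zero.mp hQ)

/-- An optimal pair may be re-topped: `(β, topExp)` is optimal too. [folklore] -/
theorem isOpt_top {γ γ' : Fin m → Fin n → ℂ[X]} {x : Fin n → Expo} {d : Fin 2 → ℤ} {ξ : Fin 2 → ℝ} {r : ℕ}
    {ρ : Fin r → Fin m ⊕ Fin m} {β : Fin r → Fin n} {s : ℕ} (h : IsOpt γ γ' x d ξ ρ β s) :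
    IsOpt γ γ' x d ξ ρ β (topExp (wtZ ξ d) (minorT γ γ' ρ β)) := by
  have hne : minorT γ γ' ρ β ≠ 0 := fun h0 => h.1 (by rw [h0, coeff_zero])
  refine ⟨coeff_topExp_ne _ hne, fun β' s' hs' => (h.2 β' s' hs').trans ?_⟩
  unfold score
  have := topExp_score_le (wtZ ξ d) h.1
  linarith

/-- SYMMETRIC EXCHANGE inside the optimal set (Grassmann–Plücker + extremality of the top exponents). -/
theorem opt_exchange {γ γ' : Fin m → Fin n → ℂ[X]} {x : Fin n → Expo} {d : Fin 2 → ℤ} {ξ : Fin 2 → ℝ} {r : ℕ}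
    {ρ : Fin r → Fin m ⊕ Fin m} {β₁ β₂ : Fin r → Fin n} {s₁ s₂ : ℕ}
    (h₁ : IsOpt γ γ' x d ξ ρ β₁ s₁) (h₂ : IsOpt γ γ' x d ξ ρ β₂ s₂) (u₁ : Fin r) :
    ∃ (u₂ : Fin r) (s₁' s₂' : ℕ), IsOpt γ γ' x d ξ ρ (Function.update β₁ u₁ (β₂ u₂)) s₁' ∧
      IsOpt γ γ' x d ξ ρ (Function.update β₂ u₂ (β₁ u₁)) s₂' := by
  set c := wtZ ξ d with hc
  have o₁ := isOpt_top h₁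
  have o₂ := isOpt_top h₂
  set t₁ := topExp c (minorT γ γ' ρ β₁)
  set t₂ := topExp c (minorT γ γ' ρ β₂)
  have hne₁ : minorT γ γ' ρ β₁ ≠ 0 := fun h0 => h₁.1 (by rw [h0, coeff_zero])
  have hne₂ : minorT γ γ' ρ β₂ ≠ 0 := fun h0 => h₂.1 (by rw [h0, coeff_zero])
  -- the `z^{t₂+t₁}` coefficient of GP
  have hprod := coeff_mul_topExp_ne c hne₂ hne₁
  rw [gp_minor γ γ' ρ β₁ β₂ u₁, finsetSum_coeff] at hprod
  obtain ⟨u₂, -, hu₂⟩ := Finset.exists_ne_zero_of_sum_ne_zero hprod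
  rw [Polynomial.coeff_mul] at hu₂
  obtain ⟨⟨i, j⟩, hij, hterm⟩ := Finset.exists_ne_zero_of_sum_ne_zero hu₂
  replace hij : i + j = _ := Finset.HasAntidiagonal.mem_antidiagonal.mp hij
  simp only at hterm
  have hi : (minorT γ γ' ρ (Function.update β₂ u₂ (β₁ u₁))).coeff i ≠ 0 := fun h0 => hterm (by rw [h0, zero_mul])
  have hj : (minorT γ γ' ρ (Function.update β₁ u₁ (β₂ u₂))).coeff j ≠ 0 := fun h0 => hterm (by rw [h0, mul_zero])
  -- scores
  have e12 : score ξ x d β₁ t₁ = score ξ x d β₂ t₂ := le_antisymm (o₂.2 β₁ t₁ o₁.1) (o₁.2 β₂ t₂ o₂.1)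
  have hA := o₁.2 _ j hj
  have hB := o₁.2 _ i hi
  have hsum : score ξ x d (Function.update β₁ u₁ (β₂ u₂)) j + score ξ x d (Function.update β₂ u₂ (β₁ u₁)) i
      = score ξ x d β₁ t₁ + score ξ x d β₂ t₂ := by
    simp only [score, wsum_update]
    have hij' : (i : ℝ) + j = (t₂ : ℝ) + t₁ := by exact_mod_cast hij
    have : (j : ℝ) * c + (i : ℝ) * c = (t₁ : ℝ) * c + (t₂ : ℝ) * c := by
      have := congrArg (· * c) hij'
      simp only [add_mul] at this
      linarith
    rw [hc] at this
    linarith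
  have hA' : score ξ x d (Function.update β₁ u₁ (β₂ u₂)) j = score ξ x d β₁ t₁ := by linarith
  have hB' : score ξ x d (Function.update β₂ u₂ (β₁ u₁)) i = score ξ x d β₁ t₁ := by linarith
  exact ⟨u₂, j, i, ⟨hj, fun β' s' hs' => hA' ▸ o₁.2 β' s' hs'⟩, ⟨hi, fun β' s' hs' => hB' ▸ o₁.2 β' s' hs'⟩⟩

/-- An optimal selection has distinct columns (a repeated column kills the minor). [folklore] -/
theorem injective_of_isOpt {γ γ' : Fin m → Fin n → ℂ[X]} {x : Fin n → Expo} {d : Fin 2 → ℤ} {ξ : Fin 2 → ℝ} {r : ℕ}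
    {ρ : Fin r → Fin m ⊕ Fin m} {β : Fin r → Fin n} {s : ℕ} (h : IsOpt γ γ' x d ξ ρ β s) :
    Function.Injective β := by
  intro u u' huu
  by_contra hne
  apply h.1
  rw [minorT_eq_rowM, Matrix.det_zero_of_row_eq hne (funext fun p => by simp [rowM, Matrix.of_apply, huu]), coeff_zero]

/-! ### Rank potential -/

/-- `#{b'' : ζ·x_{b''} < ζ·x_b}`. -/
def phiN (ζ : Fin 2 → ℝ) (x : Fin n → Expo) (b : Fin n) : ℕ :=
  (Finset.univ.filter fun b'' : Fin n => wt ζ (x b'') < wt ζ (x b)).card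

/-- The rank potential `Ψ(β) = Σ_u #{b'' : λ_{b''} < λ_{β u}}`. -/
def Psi (ζ : Fin 2 → ℝ) (x : Fin n → Expo) {r : ℕ} (β : Fin r → Fin n) : ℕ := ∑ u, phiN ζ x (β u)

/-- The rank count `φ` is monotone in the `ζ`-weight. [folklore] -/
theorem phiN_mono (ζ : Fin 2 → ℝ) (x : Fin n → Expo) {b b' : Fin n} (h : wt ζ (x b) ≤ wt ζ (x b')) :
    phiN ζ x b ≤ phiN ζ x b' :=
  Finset.card_le_card fun b'' hb'' => by
    simp only [Finset.mem_filter, Finset.mem_univ, true_and] at hb'' ⊢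
    exact lt_of_lt_of_le hb'' h

/-- The rank count `φ` is strictly monotone across a strict `ζ`-gap. [folklore] -/
theorem phiN_strict (ζ : Fin 2 → ℝ) (x : Fin n → Expo) {b b' : Fin n} (h : wt ζ (x b) < wt ζ (x b')) :
    phiN ζ x b < phiN ζ x b' := by
  refine Finset.card_lt_card (Finset.ssubset_iff_subset_ne.mpr ⟨fun b'' hb'' => ?_, fun heq => ?_⟩)
  · simp only [Finset.mem_filter, Finset.mem_univ, true_and] at hb'' ⊢
    exact hb''.trans h
  · have hb : b ∈ Finset.univ.filter fun b'' : Fin n => wt ζ (x b'') < wt ζ (x b') := by simp [h]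
    rw [← heq] at hb
    simp at hb

/-- `φ ≤ n − 1`. [folklore] -/
theorem phiN_le (ζ : Fin 2 → ℝ) (x : Fin n → Expo) (b : Fin n) : phiN ζ x b ≤ n - 1 := by
  have h : (Finset.univ.filter fun b'' : Fin n => wt ζ (x b'') < wt ζ (x b)) ⊆ Finset.univ.erase b := by
    intro b'' hb''
    simp only [Finset.mem_filter, Finset.mem_univ, true_and] at hb''
    exact Finset.mem_erase.mpr ⟨fun h => by rw [h] at hb''; exact lt_irrefl _ hb'', Finset.mem_univ _⟩
  have := Finset.card_le_card h
  rw [Finset.card_erase_of_mem (Finset.mem_univ _), Finset.card_univ, Fintype.card_fin] at this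
  exact this

/-- `Ψ ≤ r(n−1)`. [folklore] -/
theorem Psi_le (ζ : Fin 2 → ℝ) (x : Fin n → Expo) {r : ℕ} (β : Fin r → Fin n) : Psi ζ x β ≤ r * (n - 1) := by
  unfold Psi
  calc ∑ u, phiN ζ x (β u) ≤ ∑ _u : Fin r, (n - 1) := Finset.sum_le_sum fun u _ => phiN_le ζ x (β u)
    _ = r * (n - 1) := by simp

/-- `Ψ` after replacing one column. [folklore] -/
theorem Psi_update (ζ : Fin 2 → ℝ) (x : Fin n → Expo) {r : ℕ} (β : Fin r → Fin n) (u₁ : Fin r) (b : Fin n) :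
    Psi ζ x (Function.update β u₁ b) + phiN ζ x (β u₁) = Psi ζ x β + phiN ζ x b := by
  simp only [Psi]
  have h : ∀ u, phiN ζ x (Function.update β u₁ b u) + (if u = u₁ then phiN ζ x (β u₁) else 0)
      = phiN ζ x (β u) + (if u = u₁ then phiN ζ x b else 0) := by
    intro u
    by_cases hu : u = u₁
    · subst hu
      simp [add_comm]
    · simp [hu]
  have := Finset.sum_congr rfl fun u (_ : u ∈ Finset.univ) => h u
  simp only [Finset.sum_add_distrib, Finset.sum_ite_eq' Finset.univ u₁, Finset.mem_univ, if_true] at this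
  exact this

/-- A sum over an injective selection is the sum over its image. [folklore] -/
theorem sum_eq_sum_image {M : Type*} [AddCommMonoid M] {r : ℕ} (β : Fin r → Fin n) (hβ : Function.Injective β)
    (g : Fin n → M) : ∑ u, g (β u) = ∑ b ∈ Finset.univ.image β, g b := by
  rw [Finset.sum_image fun u _ u' _ h => hβ h]

/-- THE CHAIN: inside `Opt(ξ)`, walking from `β` to the `ζ`-maximal `β⁺` by GP exchanges never lowers `Ψ`, and raises it when
the `ζ`-weight rises. -/
theorem psi_chain {γ γ' : Fin m → Fin n → ℂ[X]} {x : Fin n → Expo} {d : Fin 2 → ℤ} {ξ : Fin 2 → ℝ} (ζ : Fin 2 → ℝ)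
    {r : ℕ} {ρ : Fin r → Fin m ⊕ Fin m} {βp : Fin r → Fin n} {sp : ℕ} (hp : IsOpt γ γ' x d ξ ρ βp sp)
    (hlam : ∀ (β' : Fin r → Fin n) (s' : ℕ), IsOpt γ γ' x d ξ ρ β' s' → wsum ζ x β' ≤ wsum ζ x βp) :
    ∀ (k : ℕ) (β : Fin r → Fin n) (s : ℕ), IsOpt γ γ' x d ξ ρ β s →
      (Finset.univ.filter fun u => β u ∉ Finset.univ.image βp).card = k →
      Psi ζ x β ≤ Psi ζ x βp ∧ (wsum ζ x β < wsum ζ x βp → Psi ζ x β < Psi ζ x βp) := by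
  intro k
  induction k with
  | zero =>
    intro β s hβ hk
    rw [Finset.card_eq_zero, Finset.filter_eq_empty_iff] at hk
    have hsub : Finset.univ.image β ⊆ Finset.univ.image βp := by
      intro b hb
      obtain ⟨u, -, rfl⟩ := Finset.mem_image.mp hb
      exact not_not.mp (hk (Finset.mem_univ u))
    have hinj := injective_of_isOpt hβ
    have hinjp := injective_of_isOpt hp
    have hc1 : (Finset.univ.image β).card = r := by
      rw [Finset.card_image_of_injective _ hinj, Finset.card_univ, Fintype.card_fin]
    have hc2 : (Finset.univ.image βp).card = r := by
      rw [Finset.card_image_of_injective _ hinjp, Finset.card_univ, Fintype.card_fin]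
    have heq : Finset.univ.image β = Finset.univ.image βp := Finset.eq_of_subset_of_card_le hsub (by rw [hc1, hc2])
    have hPsi : Psi ζ x β = Psi ζ x βp := by
      unfold Psi
      rw [sum_eq_sum_image β hinj, sum_eq_sum_image βp hinjp, heq]
    have hws : wsum ζ x β = wsum ζ x βp := by
      unfold wsum
      rw [sum_eq_sum_image β hinj (fun b => wt ζ (x b)), sum_eq_sum_image βp hinjp (fun b => wt ζ (x b)), heq]
    exact ⟨hPsi.le, fun h => absurd (hws ▸ h) (lt_irrefl _)⟩
  | succ k ih =>
    intro β s hβ hk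
    obtain ⟨u₁, hu₁⟩ : (Finset.univ.filter fun u => β u ∉ Finset.univ.image βp).Nonempty := by
      rw [← Finset.card_pos, hk]
      exact Nat.succ_pos k
    have hu₁' : β u₁ ∉ Finset.univ.image βp := (Finset.mem_filter.mp hu₁).2
    obtain ⟨u₂, s₁', s₂', ho₁, ho₂⟩ := opt_exchange hβ hp u₁
    have hle : wt ζ (x (β u₁)) ≤ wt ζ (x (βp u₂)) := by
      have := hlam _ _ ho₂
      rw [wsum_update] at this
      linarith
    have hk' : (Finset.univ.filter fun u => Function.update β u₁ (βp u₂) u ∉ Finset.univ.image βp).card = k := by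
      have hset : (Finset.univ.filter fun u => Function.update β u₁ (βp u₂) u ∉ Finset.univ.image βp)
          = (Finset.univ.filter fun u => β u ∉ Finset.univ.image βp).erase u₁ := by
        ext u
        simp only [Finset.mem_filter, Finset.mem_univ, true_and, Finset.mem_erase]
        by_cases hu : u = u₁
        · subst hu
          simp
        · simp [hu]
      rw [hset, Finset.card_erase_of_mem hu₁, hk]
      rfl
    obtain ⟨ih1, ih2⟩ := ih _ _ ho₁ hk'
    have hup := Psi_update ζ x β u₁ (βp u₂)
    have hmono := phiN_mono ζ x hle
    refine ⟨by omega, fun hlt => ?_⟩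
    rcases lt_or_eq_of_le hle with hlt' | heq'
    · have := phiN_strict ζ x hlt'
      omega
    · have hws : wsum ζ x (Function.update β u₁ (βp u₂)) = wsum ζ x β := by rw [wsum_update, heq']; ring
      have := ih2 (hws ▸ hlt)
      omega

end Walk

end Summit.ValiantsHypothesis.ValiantsHypothesis.Theorems.NewtonUnitEquations.TwoProducts.TowerRecord

end
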